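import Mathlib.Analysis.Calculus.IteratedDeriv.Lemmas
import Mathlib.Analysis.Calculus.MeanValue
import Mathlib.Analysis.Calculus.ContDiff.Basic
import HarnessLib

/-!
# Backward differences of sampled smooth functions: `|Δ^p f| ≤ sup |f^{(p)}|`, and lattice differences along
# a coordinate direction as one-dimensional differences

Analysis/Fourier support file (everything proved; no definitions, no named facts).  The elementary estimate that
turns smoothness of a Fourier symbol into smallness of its iterated finite differences (the discrete counterpart of
`∂_ξ^p`), as used to bound kernel moments through `TorusTrigPolyDifferences`:

* `norm_iterate_backwardDiff_le` — for `f : ℝ → F` of class `C^p` with `‖f^{(p)}‖ ≤ M` everywhere, the `p`-fold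
  backward difference `Δ^p f`, `Δ g (t) = g(t − 1) − g(t)`, satisfies `‖(Δ^p f)(t)‖ ≤ M` for all `t`
  (induction; one step is the mean value inequality applied to `f^{(p)}`);
* `iterate_latticeDiff_eq_iterate_backwardDiff` — for a lattice family sampled from `G : (d → ℝ) → F`,
  `c k = G (k)`, the `p`-fold lattice difference in direction `e_j`, `(D_j c)(k) = c(k − e_j) − c(k)`, is the `p`-fold
  backward difference of the line restriction `t ↦ G(k + t e_j)` at `t = 0`;
* `norm_iterate_latticeDiff_le` — hence `‖(D_j^p c)(k)‖ ≤ M` whenever every line restriction `t ↦ G(ξ + t e_j)` is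
  `C^p` with `p`-th derivative bounded by `M`.

(Finite differences vs derivatives: the classical `Δ_h^p f(x) = ∫_{[0,h]^p} f^{(p)}(x − s₁ − ⋯ − s_p) ds`, here in
inequality form; Grafakos 2014, §3.3.1 uses the resulting decay `|K(x)| ≲ |x|^{−p}` of kernels with smooth symbols.)
Consumer: cell `ad-ideate`, K1L_D `stmt-AnomalousDissipation-27980`, W3-E (i), kernel moment of the dissipation-scale
weight (re-plan P2c; crux memo `Lines/onelevel-W3E-k3l-lyapunov.md`).

## Mathlib / tree search
Mathlib: `iteratedDeriv_succ`, `iteratedDeriv_comp_sub_const`, `iteratedDeriv_fun_sub`, `ContDiff.differentiable_iteratedDeriv`,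
`Convex.norm_image_sub_le_of_norm_deriv_le` (mean value inequality); no finite-difference-vs-derivative lemma found
(`rg "backward difference"`, `rg fwdDiff` — Mathlib's `fwdDiff` is algebraic, without analytic bounds).

## References
* L. Grafakos, *Classical Fourier Analysis*, 3rd ed. (2014), §3.3.1. [`Grafakos2014`]
-/

noncomputable section

open Set Function

namespace Literature.Analysis.Fourier

namespace LatticeDiff

variable {F : Type*} [NormedAddCommGroup F] [NormedSpace ℝ F]

/-! ## §1 One-dimensional backward differences -/

/-- `Δ f` is `C^n` when `f` is. [folklore] -/
private theorem contDiff_backwardDiff {f : ℝ → F} {n : ℕ∞} (hf : ContDiff ℝ n f) :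
    ContDiff ℝ n (fun t => f (t - 1) - f t) :=
  (hf.comp (contDiff_id.sub contDiff_const)).sub hf

/-- The `p`-th derivative of `Δ f` is `Δ (f^{(p)})`. [folklore] -/
private theorem iteratedDeriv_backwardDiff {f : ℝ → F} {p : ℕ} (hf : ContDiff ℝ p f) (t : ℝ) :
    iteratedDeriv p (fun s => f (s - 1) - f s) t = iteratedDeriv p f (t - 1) - iteratedDeriv p f t := by
  have h1 : ContDiff ℝ p (fun s : ℝ => f (s - 1)) := hf.comp (contDiff_id.sub contDiff_const)
  rw [iteratedDeriv_fun_sub h1.contDiffAt hf.contDiffAt]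
  congr 1
  have := congrFun (iteratedDeriv_comp_sub_const (n := p) (f := f) (s := (1:ℝ))) t
  simpa using this

/-- **`‖Δ^p f‖ ≤ sup ‖f^{(p)}‖`**: if `f : ℝ → F` is `C^p` and `‖f^{(p)}(t)‖ ≤ M` for all `t`, then the `p`-fold backward
difference `Δ^p f`, `(Δ g)(t) = g(t−1) − g(t)`, obeys `‖(Δ^p f)(t)‖ ≤ M` for all `t`. [cite: Grafakos2014, §3.3.1] -/
theorem norm_iterate_backwardDiff_le (p : ℕ) :
    ∀ (f : ℝ → F) (M : ℝ), ContDiff ℝ p f → (∀ t, ‖iteratedDeriv p f t‖ ≤ M) →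
      ∀ t, ‖((fun (g : ℝ → F) (s : ℝ) => g (s - 1) - g s)^[p] f) t‖ ≤ M := by
  induction p with
  | zero =>
    intro f M _ hM t
    simpa using hM t
  | succ p ih =>
    intro f M hf hM t
    rw [Function.iterate_succ_apply]
    -- apply the induction hypothesis to `Δ f`, whose `p`-th derivative is `Δ (f^{(p)})`, bounded by `M` via the MVT
    have hfp : ContDiff ℝ p f := hf.of_le (by exact_mod_cast Nat.le_succ p)
    refine ih (fun s => f (s - 1) - f s) M (contDiff_backwardDiff hfp) (fun s => ?_) t
    rw [iteratedDeriv_backwardDiff hfp]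
    -- mean value inequality for `f^{(p)}`, whose derivative is `f^{(p+1)}`
    have hdiff : Differentiable ℝ (iteratedDeriv p f) :=
      hf.differentiable_iteratedDeriv p (by exact_mod_cast Nat.lt_succ_self p)
    have hbound : ∀ x ∈ (Set.univ : Set ℝ), ‖deriv (iteratedDeriv p f) x‖ ≤ M := fun x _ => by
      rw [← iteratedDeriv_succ]; exact hM x
    have h := Convex.norm_image_sub_le_of_norm_deriv_le (fun x _ => hdiff.differentiableAt) hbound convex_univ
      (Set.mem_univ s) (Set.mem_univ (s - 1))
    simpa using h

/-! ## §2 Lattice differences along a coordinate direction -/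

variable {d : Type*} [DecidableEq d]

omit [NormedSpace ℝ F] in
/-- **Lattice differences are sampled one-dimensional differences**: if `c k = G (k)` (integer points cast to `ℝ^d`),
then `(D_j^p c)(k) = (Δ^p (t ↦ G(k + t e_j)))(0)`, `D_j c (k) = c(k − e_j) − c(k)`, `Δ g (t) = g(t−1) − g(t)`.
[cite: Grafakos2014, §3.3.1] -/
theorem iterate_latticeDiff_eq_iterate_backwardDiff (p : ℕ) :
    ∀ (G : (d → ℝ) → F) (c : (d → ℤ) → F), (∀ k, c k = G (fun i => (k i : ℝ))) → ∀ (j : d) (k : d → ℤ),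
      ((fun (c' : (d → ℤ) → F) (k : d → ℤ) => c' (k - Pi.single j 1) - c' k)^[p] c) k =
        ((fun (g : ℝ → F) (s : ℝ) => g (s - 1) - g s)^[p]
          (fun t => G (fun i => (k i : ℝ) + t * (Pi.single j (1:ℝ) : d → ℝ) i))) 0 := by
  induction p with
  | zero =>
    intro G c hc j k
    simp [hc k]
  | succ p ih =>
    intro G c hc j k
    rw [Function.iterate_succ_apply, Function.iterate_succ_apply]
    -- the once-differenced family is sampled from `G' ξ = G (ξ − e_j) − G ξ`
    have hc' : ∀ k' : d → ℤ, c (k' - Pi.single j 1) - c k' =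
        (fun ξ : d → ℝ => G (ξ - (Pi.single j (1:ℝ) : d → ℝ)) - G ξ) (fun i => (k' i : ℝ)) := by
      intro k'
      simp only [hc]
      congr 2
      funext i
      rw [Pi.sub_apply, Pi.sub_apply]
      by_cases h : i = j
      · subst h; simp
      · simp [h]
    rw [ih (fun ξ : d → ℝ => G (ξ - (Pi.single j (1:ℝ) : d → ℝ)) - G ξ) _ hc' j k]
    have e : (fun t : ℝ => G ((fun i => (k i : ℝ) + t * (Pi.single j (1:ℝ) : d → ℝ) i) - (Pi.single j (1:ℝ) : d → ℝ)) -
          G (fun i => (k i : ℝ) + t * (Pi.single j (1:ℝ) : d → ℝ) i)) =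
        fun s : ℝ => (fun t : ℝ => G (fun i => (k i : ℝ) + t * (Pi.single j (1:ℝ) : d → ℝ) i)) (s - 1) -
          (fun t : ℝ => G (fun i => (k i : ℝ) + t * (Pi.single j (1:ℝ) : d → ℝ) i)) s := by
      funext t
      simp only
      congr 2
      funext i
      rw [Pi.sub_apply]
      ring
    rw [e]

/-- **Bound of lattice differences by directional derivatives**: if every line restriction `t ↦ G(k + t e_j)` through
integer points is `C^p` with `p`-th derivative bounded by `M`, then `‖(D_j^p c)(k)‖ ≤ M` for `c k = G(k)`.
[cite: Grafakos2014, §3.3.1] -/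
theorem norm_iterate_latticeDiff_le (p : ℕ) (G : (d → ℝ) → F) (c : (d → ℤ) → F)
    (hc : ∀ k, c k = G (fun i => (k i : ℝ))) (j : d) (M : ℝ)
    (hG : ∀ k : d → ℤ, ContDiff ℝ p (fun t : ℝ => G (fun i => (k i : ℝ) + t * (Pi.single j (1:ℝ) : d → ℝ) i)) ∧
      ∀ t, ‖iteratedDeriv p (fun t : ℝ => G (fun i => (k i : ℝ) + t * (Pi.single j (1:ℝ) : d → ℝ) i)) t‖ ≤ M)
    (k : d → ℤ) :
    ‖((fun (c' : (d → ℤ) → F) (k : d → ℤ) => c' (k - Pi.single j 1) - c' k)^[p] c) k‖ ≤ M := by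
  rw [iterate_latticeDiff_eq_iterate_backwardDiff p G c hc j k]
  exact norm_iterate_backwardDiff_le p _ M (hG k).1 (hG k).2 0

end LatticeDiff

end Literature.Analysis.Fourier

end
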